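import Mathlib.Probability.Independence.Basic
import Mathlib.Data.Set.Finite.List
import Literature.Barriers.QuantumAdvantage.AaronsonChenOracle
import HarnessLib

/-!
# `𝒟_O` toolkit: independent coins, conditioning on the rest of the oracle, determined events

Measure-theoretic support for the almost-sure half of Aaronson–Chen 2017, Thm. 5.1
(`aaronsonChen2017_thm51_ph`, arXiv:1612.05903 §5.4 [AaronsonChen2017]): "`PH^{TQBF,O}` is
infinite with probability `1` when `O ∼ 𝒟_O`". The printed proof bounds, level by level, the
probability that a fixed `PH` predicate is correct *conditionally on the rest of the oracle*
(the levels of `𝒟_O` are independent "by construction", §5.2 p. 20) and multiplies these bounds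
along infinitely many levels. Over the tree's `acOracleMeasure = acCoinMeasure.map acOracleOf`
(`AaronsonChenOracle.lean`: fair coins `setBer(univ, 1/2)` on `Set AcCoin`, read into an oracle)
this file provides exactly the three generic tools that argument needs:

* `iIndepSet_coinEvent` — the coin events `{ω | c ∈ ω}` are mutually independent under
  `acCoinMeasure` (from the cylinder formula `acCoinMeasure_cylinder`), hence
  `indep_coinSigma`: the σ-algebras `coinSigma S`, `coinSigma T` generated by disjoint sets of
  coins are independent (Mathlib's `iIndepSet.indep_generateFrom_of_disjoint`), with
  measurability criteria for coin-determined maps (`measurable_coinSigma_of_fibers`,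
  `measurable_coinSigma_set`);
* `measure_rel_inter_le` — **conditioning on an independent coordinate**: for independent
  `X` (countably valued) and `Y`, if `μ {R(X, y)} ≤ θ` for every `y ∈ G` then
  `μ ({R(X, Y)} ∩ {Y ∈ G}) ≤ θ · μ {Y ∈ G}` (product law + Tonelli);
* `measurableSet_of_determined` — an event about a language `O ⊆ {0,1}*` that only depends on
  the strings of length `≤ R` is measurable (for `Set (List Bool)` with Mathlib's product
  σ-algebra, the carrier of `acOracleMeasure` and `randomOracleMeasure`).

## References

* S. Aaronson, L. Chen, CCC 2017, arXiv:1612.05903, §5.2 (independent levels), §5.4 [AaronsonChen2017].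
* C. H. Bennett, J. Gill, SIAM J. Comput. 10 (1981), §1 (measure-one oracle arguments) [BennettGill1981].
* Mathlib: `ProbabilityTheory.iIndepSet_iff_meas_biInter`, `iIndepSet.indep_generateFrom_of_disjoint`,
  `indepFun_iff_map_prod_eq_prod_map_map`, `Measure.prod_apply_symm`.
-/

noncomputable section

namespace Literature.Barriers.QuantumAdvantage

open MeasureTheory ProbabilityTheory _root_.Computability Literature.Computability.Complexity
open scoped ENNReal

/-! ### The coins of `𝒟_O` are independent -/

/-- The event "coin `c` is heads". [folklore] -/
def coinEvent (c : AcCoin) : Set (Set AcCoin) := {ω | c ∈ ω}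

/-- Coin events are measurable. [folklore] -/
theorem measurableSet_coinEvent (c : AcCoin) : MeasurableSet (coinEvent c) :=
  measurableSet_mem c

/-- A finite intersection of coin events is a cylinder of probability `2^{-|s|}`. [folklore] -/
theorem acCoinMeasure_biInter_coinEvent (s : Finset AcCoin) :
    acCoinMeasure (⋂ c ∈ s, coinEvent c) = 2⁻¹ ^ s.card := by
  rw [← acCoinMeasure_cylinder s fun _ => True]
  congr 1
  ext ω
  simp [coinEvent]

/-- Each coin is fair. [folklore] -/
theorem acCoinMeasure_coinEvent (c : AcCoin) : acCoinMeasure (coinEvent c) = 2⁻¹ := by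
  rw [coinEvent, acCoinMeasure_mem, one_div]

/-- **The coins of `𝒟_O` are mutually independent** (a product of fair coins: the measure of a
finite intersection of coin events is the product of their measures). [cite: AaronsonChen2017, §5.2 (p. 20, "independently")] -/
theorem iIndepSet_coinEvent : iIndepSet coinEvent acCoinMeasure := by
  rw [iIndepSet_iff_meas_biInter fun c => measurableSet_coinEvent c]
  intro s
  rw [acCoinMeasure_biInter_coinEvent, Finset.prod_congr rfl fun c _ => acCoinMeasure_coinEvent c,
    Finset.prod_const]

/-- The σ-algebra generated by the coins in `T`. [folklore] -/
@[reducible] def coinSigma (T : Set AcCoin) : MeasurableSpace (Set AcCoin) :=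
  MeasurableSpace.generateFrom {E | ∃ c ∈ T, coinEvent c = E}

/-- Coin σ-algebras are sub-σ-algebras of the product σ-algebra. [folklore] -/
theorem coinSigma_le (T : Set AcCoin) : coinSigma T ≤ (inferInstance : MeasurableSpace (Set AcCoin)) :=
  MeasurableSpace.generateFrom_le (by rintro E ⟨c, -, rfl⟩; exact measurableSet_coinEvent c)

/-- A coin of `T` generates a `coinSigma T`-measurable event. [folklore] -/
theorem measurableSet_coinSigma_coinEvent {T : Set AcCoin} {c : AcCoin} (hc : c ∈ T) :
    MeasurableSet[coinSigma T] (coinEvent c) :=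
  MeasurableSpace.measurableSet_generateFrom ⟨c, hc, rfl⟩

/-- Prescribing the value of one coin of `T` is a `coinSigma T`-measurable event. [folklore] -/
theorem measurableSet_coinSigma_iff {T : Set AcCoin} {c : AcCoin} (hc : c ∈ T) (P : Prop) :
    MeasurableSet[coinSigma T] {ω | c ∈ ω ↔ P} := by
  by_cases hP : P
  · have : {ω : Set AcCoin | c ∈ ω ↔ P} = coinEvent c := by ext ω; simp [coinEvent, hP]
    rw [this]
    exact measurableSet_coinSigma_coinEvent hc
  · have : {ω : Set AcCoin | c ∈ ω ↔ P} = (coinEvent c)ᶜ := by ext ω; simp [coinEvent, hP]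
    rw [this]
    exact (measurableSet_coinSigma_coinEvent hc).compl

/-- A cylinder on coins of `T` is `coinSigma T`-measurable. [folklore] -/
theorem measurableSet_coinSigma_cylinder {T : Set AcCoin} (s : Finset AcCoin) (hs : ↑s ⊆ T)
    (v : AcCoin → Prop) : MeasurableSet[coinSigma T] {ω | ∀ c ∈ s, c ∈ ω ↔ v c} := by
  have : {ω : Set AcCoin | ∀ c ∈ s, c ∈ ω ↔ v c} = ⋂ c ∈ s, {ω | c ∈ ω ↔ v c} := by
    ext ω; simp
  rw [this]
  exact Finset.measurableSet_biInter s fun c hc => measurableSet_coinSigma_iff (hs hc) (v c)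

/-- **σ-algebras of disjoint sets of coins are independent.** [cite: AaronsonChen2017, §5.2 (p. 20, independence of the blocks "by construction")] -/
theorem indep_coinSigma {S T : Set AcCoin} (h : Disjoint S T) :
    Indep (coinSigma S) (coinSigma T) acCoinMeasure :=
  iIndepSet_coinEvent.indep_generateFrom_of_disjoint (fun c => measurableSet_coinEvent c) S T h

/-- A countably-valued map whose fibres are cylinders on coins of `T` is `coinSigma T`-measurable.
[folklore] -/
theorem measurable_coinSigma_of_fibers {𝓧 : Type*} [MeasurableSpace 𝓧] [Countable 𝓧]
    {T : Set AcCoin} {X : Set AcCoin → 𝓧}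
    (h : ∀ x : 𝓧, ∃ (s : Finset AcCoin) (v : AcCoin → Prop), ↑s ⊆ T ∧
      X ⁻¹' {x} = {ω | ∀ c ∈ s, c ∈ ω ↔ v c}) :
    Measurable[coinSigma T] X := by
  refine @measurable_to_countable' 𝓧 (Set AcCoin) _ _ (coinSigma T) X fun x => ?_
  obtain ⟨s, v, hs, hx⟩ := h x
  rw [hx]
  exact measurableSet_coinSigma_cylinder s hs v

/-- A language-valued map is `coinSigma T`-measurable as soon as each membership `z ∈ Y ω` is a
`coinSigma T`-measurable event. [folklore] -/
theorem measurable_coinSigma_set {α : Type*} {T : Set AcCoin} {Y : Set AcCoin → Set α}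
    (h : ∀ z : α, MeasurableSet[coinSigma T] {ω | z ∈ Y ω}) : Measurable[coinSigma T] Y :=
  (@measurable_set_iff α (Set AcCoin) (coinSigma T) Y).2 fun z =>
    (@measurableSet_setOf (Set AcCoin) (coinSigma T) fun ω => z ∈ Y ω).1 (h z)

/-- Independence of two coin-determined maps reading disjoint sets of coins. [cite: AaronsonChen2017, §5.2 (p. 20)] -/
theorem indepFun_of_coinSigma {𝓧 𝓨 : Type*} [m𝓧 : MeasurableSpace 𝓧] [m𝓨 : MeasurableSpace 𝓨]
    {S T : Set AcCoin} (hST : Disjoint S T) {X : Set AcCoin → 𝓧} {Y : Set AcCoin → 𝓨}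
    (hX : Measurable[coinSigma S] X) (hY : Measurable[coinSigma T] Y) :
    IndepFun X Y acCoinMeasure := by
  rw [IndepFun_iff_Indep]
  exact indep_of_indep_of_le (indep_coinSigma hST) (measurable_iff_comap_le.1 hX)
    (measurable_iff_comap_le.1 hY)

/-! ### Conditioning on an independent coordinate -/

/-- **Conditioning on an independent coordinate.** Let `X` (countably valued) and `Y` be
independent under the probability measure `μ`, `R` a relation with measurable slices and `G` a
measurable set of values of `Y`. If for every `y ∈ G` the event `R(X, y)` has probability at most
`θ`, then `μ (R(X, Y) ∧ Y ∈ G) ≤ θ · μ (Y ∈ G)` — the law of `(X, Y)` is the product of the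
marginals, and Tonelli. This is the form in which "the conditional probability, given the rest of
the oracle, that the predicate is correct at this level is at most `1/2 + o(1)`" is multiplied
along the levels. [cite: BennettGill1981, §1] -/
theorem measure_rel_inter_le {Ω 𝓧 𝓨 : Type*} [MeasurableSpace Ω] [MeasurableSpace 𝓧]
    [Countable 𝓧] [MeasurableSingletonClass 𝓧] [MeasurableSpace 𝓨] {μ : Measure Ω}
    [IsProbabilityMeasure μ] {X : Ω → 𝓧} {Y : Ω → 𝓨} (hX : Measurable X) (hY : Measurable Y)
    (hXY : IndepFun X Y μ) {R : 𝓧 → 𝓨 → Prop} (hR : ∀ x, MeasurableSet {y | R x y})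
    {G : Set 𝓨} (hG : MeasurableSet G) {θ : ℝ≥0∞} (hθ : ∀ y ∈ G, μ {ω | R (X ω) y} ≤ θ) :
    μ ({ω | R (X ω) (Y ω)} ∩ Y ⁻¹' G) ≤ θ * μ (Y ⁻¹' G) := by
  set s : Set (𝓧 × 𝓨) := {p | R p.1 p.2 ∧ p.2 ∈ G} with hs_def
  have hs : MeasurableSet s := by
    have : s = ⋃ x : 𝓧, ({x} : Set 𝓧) ×ˢ ({y | R x y} ∩ G) := by
      ext ⟨x, y⟩
      simp [hs_def]
    rw [this]
    exact MeasurableSet.iUnion fun x => (measurableSet_singleton x).prod ((hR x).inter hG)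
  have h1 : {ω | R (X ω) (Y ω)} ∩ Y ⁻¹' G = (fun ω => (X ω, Y ω)) ⁻¹' s := by
    ext ω; simp [hs_def]
  rw [h1, ← Measure.map_apply (hX.prodMk hY) hs,
    (indepFun_iff_map_prod_eq_prod_map_map hX.aemeasurable hY.aemeasurable).1 hXY,
    Measure.prod_apply_symm hs]
  have h2 : ∀ y, (μ.map X) ((fun x => (x, y)) ⁻¹' s) ≤ G.indicator (fun _ => θ) y := by
    intro y
    by_cases hy : y ∈ G
    · rw [Set.indicator_of_mem hy]
      have : (fun x => (x, y)) ⁻¹' s = {x | R x y} := by ext x; simp [hs_def, hy]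
      rw [this, Measure.map_apply hX (Set.to_countable _).measurableSet]
      exact hθ y hy
    · have : (fun x => (x, y)) ⁻¹' s = ∅ := by ext x; simp [hs_def, hy]
      simp [this]
  calc ∫⁻ y, (μ.map X) ((fun x => (x, y)) ⁻¹' s) ∂(μ.map Y)
      ≤ ∫⁻ y, G.indicator (fun _ => θ) y ∂(μ.map Y) := lintegral_mono h2
    _ = θ * (μ.map Y) G := lintegral_indicator_const hG θ
    _ = θ * μ (Y ⁻¹' G) := by rw [Measure.map_apply hY hG]

/-! ### Events determined by finitely many strings are measurable -/

/-- **An event about a language that only depends on its strings of length at most `R` is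
measurable** (`Set (List Bool)` with the product σ-algebra): it is the preimage, under the
measurable finite restriction map, of a subset of a countable discrete space.
[cite: BennettGill1981, §1] -/
theorem measurableSet_of_determined (R : ℕ) {P : Set (List Bool) → Prop}
    (h : ∀ O O' : Set (List Bool),
      (∀ s : List Bool, s.length ≤ R → (s ∈ O ↔ s ∈ O')) → (P O ↔ P O')) :
    MeasurableSet {O | P O} := by
  haveI : Finite {s : List Bool // s.length ≤ R} := (List.finite_length_le Bool R).to_subtype
  let F : Set (List Bool) → ({s : List Bool // s.length ≤ R} → Prop) := fun O t => t.1 ∈ O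
  have hF : Measurable F := measurable_pi_iff.2 fun t => measurable_set_mem t.1
  let back : ({s : List Bool // s.length ≤ R} → Prop) → Set (List Bool) :=
    fun v => {s | ∃ hs : s.length ≤ R, v ⟨s, hs⟩}
  have hPF : ∀ O, P O ↔ P (back (F O)) := fun O =>
    h O _ fun s hs => by simp [back, F, hs]
  have hset : {O | P O} = F ⁻¹' {v | P (back v)} := by
    ext O
    exact hPF O
  rw [hset]
  exact hF (Set.to_countable _).measurableSet

end Literature.Barriers.QuantumAdvantage

end
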